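import Summits.QuantumFields.YangMills.Theses.SqueezedSkewness
import Summits.QuantumFields.YangMills.Theorems.SqueezedSkewnessVacuumDominationKLGlue
import Summits.QuantumFields.YangMills.Theorems.SqueezedSkewnessThermalLimit
import Summits.QuantumFields.YangMills.Theorems.SqueezedSkewnessSpectralIdentification
import HarnessLib

/-!
# Route `SqueezedSkewness`, item `VacuumDomination` (stmt-QuantumFields-28192) — the derived split theorem, materialised

`SqueezedSkewness.VacuumDomination` was closed BY SPLIT (LINE 1 «KL split», route rev 9): children `ThermalLimit`
(stmt-QuantumFields-22661, `SqueezedSkewnessThermalLimit.thermalLimit_proof`) and `SpectralIdentification` (stmt-QuantumFields-22662,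
`TorusKL.spectralIdentification_proof`), glue `VacuumDominationKLGlue : ThermalLimit → SpectralIdentification → VacuumDomination`
(stmt-QuantumFields-22663, `SqueezedSkewnessVacuumDominationKLGlue.vacuumDominationKLGlue_proof`).  All three are landed and
kernel-checked; this file records the composition so that the item closes on a declaration that resolves (ledger BY-SPLIT sweep
2026-08-30, director-ym R569-ym (3)).

HONEST FRAMING: a finite-torus transfer-matrix / Källén–Lehmann statement (thermal limit of the reflection form and its spectral
identification); nothing about the continuum limit; `BalabanLadder.NT` and the Yang–Mills mass gap are NOT proved.  No `sorry`,
no new axiom, no new definition.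
-/

set_option autoImplicit false

namespace Summit.QuantumFields.YangMills.Theorems

/-- ★ **`SqueezedSkewness.VacuumDomination` holds** (item stmt-QuantumFields-28192, BY NAME): the glue `vacuumDominationKLGlue_proof`
applied to the two landed children `thermalLimit_proof` and `spectralIdentification_proof`.  The Yang–Mills mass gap is NOT proved. -/
theorem squeezedSkewness_vacuumDomination_proof :
    Summit.QuantumFields.YangMills.Theses.SqueezedSkewness.VacuumDomination :=
  Summit.QuantumFields.YangMills.Theorems.SqueezedSkewnessVacuumDominationKLGlue.vacuumDominationKLGlue_proof
    Summit.QuantumFields.YangMills.Theorems.SqueezedSkewnessThermalLimit.thermalLimit_proof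
    Summit.QuantumFields.YangMills.Theorems.TorusKL.spectralIdentification_proof

end Summit.QuantumFields.YangMills.Theorems
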